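import Summits.CriticalPhenomena.PercolationContinuityZ3.Theorems.PercNearOneGluingNoHeavyLowerTailKnQuestion8CoefficientwiseSeries
import Summits.CriticalPhenomena.PercolationContinuityZ3.Theorems.PercNearOneGluingNoHeavyLowerTailKnQuestion8CoefficientwiseParallelClosure
import Summits.CriticalPhenomena.PercolationContinuityZ3.Theorems.PercNearOneGluingNoHeavyLowerTailKnQuestion8CoefficientwiseSubdivision
import Mathlib.Data.Fin.VecNotation
import HarnessLib

/-!
# The theta graph — the first two-terminal network that is NOT series–parallel — satisfies the coefficientwise first rung

Support file (`--supports stmt-CriticalPhenomena-4575`, closed), prover `prim-lf-2` (gen 26).  No definitions, no named facts, no sorries; standard axioms.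
Memo `prim-lf-2/CW-REDUCTION-gen26.md` §4(a): THEOREM Θ as a corollary of the reduction calculus.  This file runs the calculus in Lean on its first instance
Θ(1) = {x–a, x–b, a–z, b–z, a–c–b} (vertices `x z a b c = 0 1 2 3 4 : Fin 5`, edges `xa xb za zb ab ac cb = 0 … 6 : Fin 7` of the ambient multigraph):
* `Coefficientwise.cwpa_theta_C4` — the 4-cycle `{xa, xb, za, zb}` is in `𝒞` (two single edges in series, twice, in parallel: `cwpa_of_adj`, `cwpa_series`,
  `cwpa_parallel`);
* `Coefficientwise.cwpa_theta_W0_marked` — the Wheatstone bridge `W₀ = {xa, xb, za, zb, ab}` is in `𝒞^{(ab)}` POINTWISE: its wall forces `xa, xb` to have the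
  same colour, so one enriched cluster is `{x}` and the other contains it;
* `Coefficientwise.cwpa_theta` — **Θ(1) ∈ 𝒞**: `0 ≤ Σ_{s ⊆ Θ : no monochromatic x–z path} (f(C_x s) − f(C_x(Θ∖s)))(g(C_x s) − g(C_x(Θ∖s)))` for all monotone `f, g`,
  by `cwpa_subdivide` (the bridge `ab` subdivided into `a–c–b`).
[cite: KozmaNitzan2024, Questions 8–9 (§5.5 p. 36) (context: first rung of the coefficientwise programme for Question 8)]
-/

namespace Summit.CriticalPhenomena.PercolationContinuityZ3.Theorems

open Finset Literature.Probability.Percolation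

namespace Coefficientwise

/-- An edge of `t` with ends `{p, q}`, `p ≠ q`, makes `p, q` adjacent in the red graph of `t`. [cite: KozmaNitzan2024, §5.5 (context only; folklore)] -/
theorem openGraph_adj_of_mem {ι V : Type*} (ends : ι → Sym2 V) {t : Finset ι} {i : ι} {p q : V} (hi : i ∈ t) (hpq : ends i = s(p, q))
    (hne : p ≠ q) : (openGraph (ends '' (↑t : Set ι))).Adj p q := by
  rw [openGraph_image_adj]; exact ⟨⟨i, hi, hpq⟩, hne⟩

/-- A vertex of the red cluster of `a` other than `a` forces a red edge AT `a` (the first edge of a path). [cite: KozmaNitzan2024, §5.5 (context only; folklore)] -/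
theorem exists_edge_at_root_of_mem_openCluster {ι V : Type*} (ends : ι → Sym2 V) {t : Finset ι} {a y : V}
    (hy : y ∈ openCluster (ends '' (↑t : Set ι)) a) (hya : y ≠ a) : ∃ i ∈ t, a ∈ ends i := by
  change (openGraph (ends '' (↑t : Set ι))).Reachable a y at hy
  rw [SimpleGraph.reachable_iff_reflTransGen] at hy
  rcases Relation.ReflTransGen.cases_head hy with h | ⟨w, haw, _⟩
  · exact absurd h.symm hya
  · rw [openGraph_image_adj] at haw
    obtain ⟨⟨i, hi, hiends⟩, _⟩ := haw
    exact ⟨i, hi, by rw [hiends]; exact Sym2.mem_mk_left a w⟩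


/-! ### Decidable side facts about the ambient 7-edge multigraph (proved by `decide`, outside any classical scope) -/
section facts

/-- The end-point map of the ambient multigraph: `xa xb za zb ab ac cb`. (Local abbreviation inside statements only.)
[cite: KozmaNitzan2024, §5.5 (context only)] -/
theorem theta_ends_vals :
    (![s(0, 2), s(0, 3), s(1, 2), s(1, 3), s(2, 3), s(2, 4), s(4, 3)] : Fin 7 → Sym2 (Fin 5)) 0 = s(0, 2) ∧
    (![s(0, 2), s(0, 3), s(1, 2), s(1, 3), s(2, 3), s(2, 4), s(4, 3)] : Fin 7 → Sym2 (Fin 5)) 1 = s(0, 3) ∧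
    (![s(0, 2), s(0, 3), s(1, 2), s(1, 3), s(2, 3), s(2, 4), s(4, 3)] : Fin 7 → Sym2 (Fin 5)) 2 = s(1, 2) ∧
    (![s(0, 2), s(0, 3), s(1, 2), s(1, 3), s(2, 3), s(2, 4), s(4, 3)] : Fin 7 → Sym2 (Fin 5)) 3 = s(1, 3) ∧
    (![s(0, 2), s(0, 3), s(1, 2), s(1, 3), s(2, 3), s(2, 4), s(4, 3)] : Fin 7 → Sym2 (Fin 5)) 4 = s(2, 3) ∧
    (![s(0, 2), s(0, 3), s(1, 2), s(1, 3), s(2, 3), s(2, 4), s(4, 3)] : Fin 7 → Sym2 (Fin 5)) 5 = s(2, 4) ∧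
    (![s(0, 2), s(0, 3), s(1, 2), s(1, 3), s(2, 3), s(2, 4), s(4, 3)] : Fin 7 → Sym2 (Fin 5)) 6 = s(4, 3) := by
  refine ⟨rfl, rfl, rfl, rfl, rfl, rfl, rfl⟩

/-- Edges of the two `x–z` routes of the 4-cycle meet only at their middle vertex / at the terminals; terminal incidences. [cite: KozmaNitzan2024, §5.5 (context only)] -/
theorem theta_route_facts :
    (∀ e ∈ ({0} : Finset (Fin 7)), ∀ e' ∈ ({2} : Finset (Fin 7)), ∀ w : Fin 5,
      w ∈ (![s(0, 2), s(0, 3), s(1, 2), s(1, 3), s(2, 3), s(2, 4), s(4, 3)] : Fin 7 → Sym2 (Fin 5)) e →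
      w ∈ (![s(0, 2), s(0, 3), s(1, 2), s(1, 3), s(2, 3), s(2, 4), s(4, 3)] : Fin 7 → Sym2 (Fin 5)) e' → w = 2) ∧
    (∀ e ∈ ({1} : Finset (Fin 7)), ∀ e' ∈ ({3} : Finset (Fin 7)), ∀ w : Fin 5,
      w ∈ (![s(0, 2), s(0, 3), s(1, 2), s(1, 3), s(2, 3), s(2, 4), s(4, 3)] : Fin 7 → Sym2 (Fin 5)) e →
      w ∈ (![s(0, 2), s(0, 3), s(1, 2), s(1, 3), s(2, 3), s(2, 4), s(4, 3)] : Fin 7 → Sym2 (Fin 5)) e' → w = 3) ∧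
    (∀ e ∈ ({0} ∪ {2} : Finset (Fin 7)), ∀ e' ∈ ({1} ∪ {3} : Finset (Fin 7)), ∀ w : Fin 5,
      w ∈ (![s(0, 2), s(0, 3), s(1, 2), s(1, 3), s(2, 3), s(2, 4), s(4, 3)] : Fin 7 → Sym2 (Fin 5)) e →
      w ∈ (![s(0, 2), s(0, 3), s(1, 2), s(1, 3), s(2, 3), s(2, 4), s(4, 3)] : Fin 7 → Sym2 (Fin 5)) e' → w = 0 ∨ w = 1) ∧
    (∀ e ∈ ({2} : Finset (Fin 7)), (0 : Fin 5) ∉ (![s(0, 2), s(0, 3), s(1, 2), s(1, 3), s(2, 3), s(2, 4), s(4, 3)] : Fin 7 → Sym2 (Fin 5)) e) ∧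
    (∀ e ∈ ({0} : Finset (Fin 7)), (1 : Fin 5) ∉ (![s(0, 2), s(0, 3), s(1, 2), s(1, 3), s(2, 3), s(2, 4), s(4, 3)] : Fin 7 → Sym2 (Fin 5)) e) ∧
    (∀ e ∈ ({3} : Finset (Fin 7)), (0 : Fin 5) ∉ (![s(0, 2), s(0, 3), s(1, 2), s(1, 3), s(2, 3), s(2, 4), s(4, 3)] : Fin 7 → Sym2 (Fin 5)) e) ∧
    (∀ e ∈ ({1} : Finset (Fin 7)), (1 : Fin 5) ∉ (![s(0, 2), s(0, 3), s(1, 2), s(1, 3), s(2, 3), s(2, 4), s(4, 3)] : Fin 7 → Sym2 (Fin 5)) e) := by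
  refine ⟨?_, ?_, ?_, ?_, ?_, ?_, ?_⟩ <;> decide

/-- In `W₀ = {xa, xb, za, zb, ab}` the only edges at `x` are `xa, xb`, and no edge meets `c`. [cite: KozmaNitzan2024, §5.5 (context only)] -/
theorem theta_W0_facts :
    (∀ i ∈ ({0, 1, 2, 3, 4} : Finset (Fin 7)), (0 : Fin 5) ∈ (![s(0, 2), s(0, 3), s(1, 2), s(1, 3), s(2, 3), s(2, 4), s(4, 3)] : Fin 7 → Sym2 (Fin 5)) i →
      i = 0 ∨ i = 1) ∧
    (∀ i ∈ ({0, 1, 2, 3, 4} : Finset (Fin 7)), (4 : Fin 5) ∉ (![s(0, 2), s(0, 3), s(1, 2), s(1, 3), s(2, 3), s(2, 4), s(4, 3)] : Fin 7 → Sym2 (Fin 5)) i) := by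
  refine ⟨?_, ?_⟩ <;> decide

end facts

open Classical in
/-- The 4-cycle `x–a–z–b–x` (edges `0 = xa, 1 = xb, 2 = za, 3 = zb` of the ambient 7-edge multigraph) is in `𝒞`: series of two edges, twice, in parallel.
[cite: KozmaNitzan2024, Questions 8–9 (§5.5 p. 36) (context)] -/
theorem cwpa_theta_C4 (ends : Fin 7 → Sym2 (Fin 5))
    (hends : ends = ![s(0, 2), s(0, 3), s(1, 2), s(1, 3), s(2, 3), s(2, 4), s(4, 3)])
    (f g : Set (Fin 5) → ℝ) (hf : Monotone f) (hg : Monotone g) :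
    0 ≤ ∑ s ∈ ({0, 1, 2, 3} : Finset (Fin 7)).powerset.filter (fun s : Finset (Fin 7) =>
          (1 : Fin 5) ∉ openCluster (ends '' (↑s : Set (Fin 7))) 0 ∧
          (1 : Fin 5) ∉ openCluster (ends '' (↑(({0, 1, 2, 3} : Finset (Fin 7)) \ s) : Set (Fin 7))) 0),
      (f (openCluster (ends '' (↑s : Set (Fin 7))) 0) - f (openCluster (ends '' (↑(({0, 1, 2, 3} : Finset (Fin 7)) \ s) : Set (Fin 7))) 0)) *
        (g (openCluster (ends '' (↑s : Set (Fin 7))) 0) - g (openCluster (ends '' (↑(({0, 1, 2, 3} : Finset (Fin 7)) \ s) : Set (Fin 7))) 0)) := by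
  subst hends
  obtain ⟨e0, e1, e2, e3, e4, e5, e6⟩ := theta_ends_vals
  obtain ⟨sepA, sepB, sepPar, nx2, nz0, nx3, nz1⟩ := theta_route_facts
  -- the two paths x–a–z (edges 0, 2 through a = 2) and x–b–z (edges 1, 3 through b = 3)
  have pathA := cwpa_series (![s(0, 2), s(0, 3), s(1, 2), s(1, 3), s(2, 3), s(2, 4), s(4, 3)] : Fin 7 → Sym2 (Fin 5))
    (E₁ := {0}) (E₂ := {2}) (Finset.disjoint_singleton.mpr (by decide)) (x := (0 : Fin 5)) (v := (2 : Fin 5)) (z := (1 : Fin 5))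
    sepA nx2 nz0 (by decide)
    (fun φ ψ _ _ => cwpa_of_adj _ {0} (e := 0) (by simp) e0 (by decide) φ ψ)
    (fun φ ψ _ _ => cwpa_of_adj _ {2} (e := 2) (by simp) (e2.trans Sym2.eq_swap) (by decide) φ ψ)
  have pathB := cwpa_series (![s(0, 2), s(0, 3), s(1, 2), s(1, 3), s(2, 3), s(2, 4), s(4, 3)] : Fin 7 → Sym2 (Fin 5))
    (E₁ := {1}) (E₂ := {3}) (Finset.disjoint_singleton.mpr (by decide)) (x := (0 : Fin 5)) (v := (3 : Fin 5)) (z := (1 : Fin 5))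
    sepB nx3 nz1 (by decide)
    (fun φ ψ _ _ => cwpa_of_adj _ {1} (e := 1) (by simp) e1 (by decide) φ ψ)
    (fun φ ψ _ _ => cwpa_of_adj _ {3} (e := 3) (by simp) (e3.trans Sym2.eq_swap) (by decide) φ ψ)
  have hdisj : Disjoint ({0} ∪ {2} : Finset (Fin 7)) ({1} ∪ {3}) := by decide
  have par := cwpa_parallel (![s(0, 2), s(0, 3), s(1, 2), s(1, 3), s(2, 3), s(2, 4), s(4, 3)] : Fin 7 → Sym2 (Fin 5))
    (E₁ := {0} ∪ {2}) (E₂ := {1} ∪ {3}) hdisj (x := (0 : Fin 5)) (z := (1 : Fin 5)) sepPar pathA pathB f g hf hg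
  have hE : ({0} ∪ {2} ∪ ({1} ∪ {3}) : Finset (Fin 7)) = {0, 1, 2, 3} := by decide
  rw [hE] at par
  exact par

open Classical in
/-- The Wheatstone bridge `W₀ = {xa, xb, za, zb, ab}` is in `𝒞^{(ab)}` pointwise: in its wall `xa` and `xb` carry the same colour, so one enriched cluster is `{x}` and
the other contains `x`; each summand is a product of two numbers of the same sign.  (The bit of `ab` is carried by the vertex `c = 4`, which meets no edge of `W₀`.)
[cite: KozmaNitzan2024, Questions 8–9 (§5.5 p. 36) (context)] -/
theorem cwpa_theta_W0_marked (ends : Fin 7 → Sym2 (Fin 5))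
    (hends : ends = ![s(0, 2), s(0, 3), s(1, 2), s(1, 3), s(2, 3), s(2, 4), s(4, 3)])
    (φ ψ : Set (Fin 5) → ℝ) (hφ : Monotone φ) (hψ : Monotone ψ) :
    0 ≤ ∑ s ∈ ({0, 1, 2, 3, 4} : Finset (Fin 7)).powerset.filter (fun s : Finset (Fin 7) =>
          (1 : Fin 5) ∉ openCluster (ends '' (↑s : Set (Fin 7))) 0 ∧
          (1 : Fin 5) ∉ openCluster (ends '' (↑(({0, 1, 2, 3, 4} : Finset (Fin 7)) \ s) : Set (Fin 7))) 0),
      (φ (openCluster (ends '' (↑s : Set (Fin 7))) 0 ∪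
            {y | (y = 4 ∨ y = 4) ∧ (4 : Fin 7) ∈ s ∧ (2 : Fin 5) ∈ openCluster (ends '' (↑s : Set (Fin 7))) 0}) -
          φ (openCluster (ends '' (↑(({0, 1, 2, 3, 4} : Finset (Fin 7)) \ s) : Set (Fin 7))) 0 ∪
            {y | (y = 4 ∨ y = 4) ∧ (4 : Fin 7) ∈ ({0, 1, 2, 3, 4} : Finset (Fin 7)) \ s ∧
              (2 : Fin 5) ∈ openCluster (ends '' (↑(({0, 1, 2, 3, 4} : Finset (Fin 7)) \ s) : Set (Fin 7))) 0})) *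
        (ψ (openCluster (ends '' (↑s : Set (Fin 7))) 0 ∪
            {y | (y = 4 ∨ y = 4) ∧ (4 : Fin 7) ∈ s ∧ (2 : Fin 5) ∈ openCluster (ends '' (↑s : Set (Fin 7))) 0}) -
          ψ (openCluster (ends '' (↑(({0, 1, 2, 3, 4} : Finset (Fin 7)) \ s) : Set (Fin 7))) 0 ∪
            {y | (y = 4 ∨ y = 4) ∧ (4 : Fin 7) ∈ ({0, 1, 2, 3, 4} : Finset (Fin 7)) \ s ∧
              (2 : Fin 5) ∈ openCluster (ends '' (↑(({0, 1, 2, 3, 4} : Finset (Fin 7)) \ s) : Set (Fin 7))) 0})) := by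
  subst hends
  set en : Fin 7 → Sym2 (Fin 5) := ![s(0, 2), s(0, 3), s(1, 2), s(1, 3), s(2, 3), s(2, 4), s(4, 3)] with hen
  set W : Finset (Fin 7) := {0, 1, 2, 3, 4} with hW
  set K : Finset (Fin 7) → Set (Fin 5) := fun s => openCluster (en '' (↑s : Set (Fin 7))) 0 with hK
  change 0 ≤ ∑ s ∈ W.powerset.filter (fun s => (1 : Fin 5) ∉ K s ∧ (1 : Fin 5) ∉ K (W \ s)),
    (φ (K s ∪ {y | (y = 4 ∨ y = 4) ∧ (4 : Fin 7) ∈ s ∧ (2 : Fin 5) ∈ K s}) -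
        φ (K (W \ s) ∪ {y | (y = 4 ∨ y = 4) ∧ (4 : Fin 7) ∈ W \ s ∧ (2 : Fin 5) ∈ K (W \ s)})) *
      (ψ (K s ∪ {y | (y = 4 ∨ y = 4) ∧ (4 : Fin 7) ∈ s ∧ (2 : Fin 5) ∈ K s}) -
        ψ (K (W \ s) ∪ {y | (y = 4 ∨ y = 4) ∧ (4 : Fin 7) ∈ W \ s ∧ (2 : Fin 5) ∈ K (W \ s)}))
  have e0 : en 0 = s(0, 2) := theta_ends_vals.1
  have e1 : en 1 = s(0, 3) := theta_ends_vals.2.1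
  have e2 : en 2 = s(1, 2) := theta_ends_vals.2.2.1
  have e3 : en 3 = s(1, 3) := theta_ends_vals.2.2.2.1
  have e4 : en 4 = s(2, 3) := theta_ends_vals.2.2.2.2.1
  -- an edge of `W` at the root `x = 0` is `xa` or `xb`
  have root_edges : ∀ i ∈ W, (0 : Fin 5) ∈ en i → i = 0 ∨ i = 1 := theta_W0_facts.1
  -- if `t ⊆ W` has no edge at `0`, the red cluster of `0` is `{0}`
  have K_root : ∀ t : Finset (Fin 7), t ⊆ W → (0 : Fin 7) ∉ t → (1 : Fin 7) ∉ t → ∀ y, y ∈ K t → y = 0 := by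
    intro t ht h0 h1 y hy
    by_contra hy0
    obtain ⟨i, hi, hxi⟩ := exists_edge_at_root_of_mem_openCluster en hy hy0
    rcases root_edges i (ht hi) hxi with rfl | rfl
    · exact h0 hi
    · exact h1 hi
  refine Finset.sum_nonneg fun s hs => ?_
  obtain ⟨hsW, hz1, hz2⟩ := Finset.mem_filter.mp hs
  have hsW' : s ⊆ W := Finset.mem_powerset.mp hsW
  have hdW : W \ s ⊆ W := Finset.sdiff_subset
  have memd : ∀ i : Fin 7, i ∈ W → (i ∈ W \ s ↔ i ∉ s) := fun i hi => by
    rw [Finset.mem_sdiff]; exact ⟨fun h => h.2, fun h => ⟨hi, h⟩⟩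
  have hW0 : (0 : Fin 7) ∈ W := by decide
  have hW1 : (1 : Fin 7) ∈ W := by decide
  have hW2 : (2 : Fin 7) ∈ W := by decide
  have hW3 : (3 : Fin 7) ∈ W := by decide
  have hW4 : (4 : Fin 7) ∈ W := by decide
  -- reachability helpers: a red (in `t`) path of two or three edges from `0` to `1` puts `1` in `K t`
  have reach2 : ∀ t : Finset (Fin 7), ∀ {i j : Fin 7} {p : Fin 5}, i ∈ t → j ∈ t → en i = s(0, p) → en j = s(1, p) → p ≠ 0 → p ≠ 1 →
      (1 : Fin 5) ∈ K t := by
    intro t i j p hi hj hei hej hp0 hp1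
    have h1 : (openGraph (en '' (↑t : Set (Fin 7)))).Adj 0 p := openGraph_adj_of_mem en hi hei hp0.symm
    have h2 : (openGraph (en '' (↑t : Set (Fin 7)))).Adj p 1 :=
      (openGraph_adj_of_mem en hj hej hp1.symm).symm
    exact h1.reachable.trans h2.reachable
  have reach3 : ∀ t : Finset (Fin 7), ∀ {i j k : Fin 7} {p q : Fin 5}, i ∈ t → j ∈ t → k ∈ t → en i = s(0, p) → en j = s(p, q) ∨ en j = s(q, p) →
      en k = s(1, q) → p ≠ 0 → p ≠ q → q ≠ 1 → (1 : Fin 5) ∈ K t := by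
    intro t i j k p q hi hj hk hei hej hek hp0 hpq hq1
    have h1 : (openGraph (en '' (↑t : Set (Fin 7)))).Adj 0 p := openGraph_adj_of_mem en hi hei hp0.symm
    have h2 : (openGraph (en '' (↑t : Set (Fin 7)))).Adj p q := by
      rcases hej with hej | hej
      · exact openGraph_adj_of_mem en hj hej hpq
      · exact (openGraph_adj_of_mem en hj hej hpq.symm).symm
    have h3 : (openGraph (en '' (↑t : Set (Fin 7)))).Adj q 1 := (openGraph_adj_of_mem en hk hek hq1.symm).symm
    exact (h1.reachable.trans h2.reachable).trans h3.reachable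
  -- the wall forces `xa ∈ s ↔ xb ∈ s`
  have key : ((0 : Fin 7) ∈ s ↔ (1 : Fin 7) ∈ s) := by
    constructor
    · intro h0
      by_contra h1
      have h1' : (1 : Fin 7) ∈ W \ s := (memd 1 hW1).mpr h1
      by_cases h2 : (2 : Fin 7) ∈ s
      · exact hz1 (reach2 s h0 h2 e0 e2 (by decide) (by decide))
      · have h2' : (2 : Fin 7) ∈ W \ s := (memd 2 hW2).mpr h2
        by_cases h4 : (4 : Fin 7) ∈ s
        · by_cases h3 : (3 : Fin 7) ∈ s
          · exact hz1 (reach3 s h0 h4 h3 e0 (Or.inl e4) e3 (by decide) (by decide) (by decide))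
          · have h3' : (3 : Fin 7) ∈ W \ s := (memd 3 hW3).mpr h3
            exact hz2 (reach2 (W \ s) h1' h3' e1 e3 (by decide) (by decide))
        · have h4' : (4 : Fin 7) ∈ W \ s := (memd 4 hW4).mpr h4
          exact hz2 (reach3 (W \ s) h1' h4' h2' e1 (Or.inr e4) e2 (by decide) (by decide) (by decide))
    · intro h1
      by_contra h0
      have h0' : (0 : Fin 7) ∈ W \ s := (memd 0 hW0).mpr h0
      by_cases h3 : (3 : Fin 7) ∈ s
      · exact hz1 (reach2 s h1 h3 e1 e3 (by decide) (by decide))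
      · have h3' : (3 : Fin 7) ∈ W \ s := (memd 3 hW3).mpr h3
        by_cases h4 : (4 : Fin 7) ∈ s
        · by_cases h2 : (2 : Fin 7) ∈ s
          · exact hz1 (reach3 s h1 h4 h2 e1 (Or.inr e4) e2 (by decide) (by decide) (by decide))
          · have h2' : (2 : Fin 7) ∈ W \ s := (memd 2 hW2).mpr h2
            exact hz2 (reach2 (W \ s) h0' h2' e0 e2 (by decide) (by decide))
        · have h4' : (4 : Fin 7) ∈ W \ s := (memd 4 hW4).mpr h4
          exact hz2 (reach3 (W \ s) h0' h4' h3' e0 (Or.inl e4) e3 (by decide) (by decide) (by decide))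
  -- in either case one side is `{0}` and the other contains `0`
  have xmem : ∀ t : Finset (Fin 7), ∀ P : Prop, (0 : Fin 5) ∈ K t ∪ {y | (y = 4 ∨ y = 4) ∧ P} :=
    fun t P => Or.inl (mem_openCluster_self _ _)
  have small : ∀ t : Finset (Fin 7), t ⊆ W → (0 : Fin 7) ∉ t → (1 : Fin 7) ∉ t → ∀ P : Prop,
      K t ∪ {y | (y = 4 ∨ y = 4) ∧ P ∧ (2 : Fin 5) ∈ K t} ⊆ {0} := by
    intro t ht h0 h1 P y hy
    rcases hy with hy | ⟨_, _, h2⟩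
    · exact K_root t ht h0 h1 y hy
    · exact absurd (K_root t ht h0 h1 2 h2) (by decide)
  have sub0 : ∀ X : Set (Fin 5), (0 : Fin 5) ∈ X → ({0} : Set (Fin 5)) ⊆ X := fun X h y hy => by
    rw [Set.mem_singleton_iff] at hy; rw [hy]; exact h
  by_cases h0 : (0 : Fin 7) ∈ s
  · -- `xa, xb` red: the blue side is `{0}`
    have h1 : (1 : Fin 7) ∈ s := key.mp h0
    have hsmall := small (W \ s) hdW (fun h => (Finset.mem_sdiff.mp h).2 h0) (fun h => (Finset.mem_sdiff.mp h).2 h1) ((4 : Fin 7) ∈ W \ s)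
    have hle : K (W \ s) ∪ {y | (y = 4 ∨ y = 4) ∧ (4 : Fin 7) ∈ W \ s ∧ (2 : Fin 5) ∈ K (W \ s)} ⊆
        K s ∪ {y | (y = 4 ∨ y = 4) ∧ (4 : Fin 7) ∈ s ∧ (2 : Fin 5) ∈ K s} :=
      hsmall.trans (sub0 _ (xmem s _))
    exact mul_nonneg (sub_nonneg.mpr (hφ hle)) (sub_nonneg.mpr (hψ hle))
  · -- `xa, xb` blue: the red side is `{0}`
    have h1 : (1 : Fin 7) ∉ s := fun h => h0 (key.mpr h)
    have hsmall := small s hsW' h0 h1 ((4 : Fin 7) ∈ s)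
    have hle : K s ∪ {y | (y = 4 ∨ y = 4) ∧ (4 : Fin 7) ∈ s ∧ (2 : Fin 5) ∈ K s} ⊆
        K (W \ s) ∪ {y | (y = 4 ∨ y = 4) ∧ (4 : Fin 7) ∈ W \ s ∧ (2 : Fin 5) ∈ K (W \ s)} :=
      hsmall.trans (sub0 _ (xmem (W \ s) _))
    exact mul_nonneg_of_nonpos_of_nonpos (sub_nonpos.mpr (hφ hle)) (sub_nonpos.mpr (hψ hle))

open Classical in
/-- **THEOREM Θ(1): the theta graph is in `𝒞`.**  For the two-terminal graph `Θ = {x–a, x–b, a–z, b–z, a–c, c–b}` (terminals `x = 0`, `z = 1`; edges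
`{0,1,2,3,5,6}` of the ambient 7-edge multigraph whose edge `4 = ab` is the unsubdivided bridge) and all monotone `f, g`,
`0 ≤ Σ_{s ⊆ Θ : no monochromatic x–z path} (f(C_x s) − f(C_x(Θ∖s)))·(g(C_x s) − g(C_x(Θ∖s)))`.
Proof: `cwpa_subdivide` with `H = W₀` (in `𝒞^{(ab)}`, `cwpa_theta_W0_marked`) and `H − ab = C₄` (`cwpa_theta_C4`).  Θ(1) is the smallest two-terminal graph outside the
series–parallel class of THEOREM SP.  [cite: KozmaNitzan2024, Questions 8–9 (§5.5 p. 36) (context)] -/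
theorem cwpa_theta (ends : Fin 7 → Sym2 (Fin 5))
    (hends : ends = ![s(0, 2), s(0, 3), s(1, 2), s(1, 3), s(2, 3), s(2, 4), s(4, 3)])
    (f g : Set (Fin 5) → ℝ) (hf : Monotone f) (hg : Monotone g) :
    0 ≤ ∑ s ∈ ({0, 1, 2, 3, 5, 6} : Finset (Fin 7)).powerset.filter (fun s : Finset (Fin 7) =>
          (1 : Fin 5) ∉ openCluster (ends '' (↑s : Set (Fin 7))) 0 ∧
          (1 : Fin 5) ∉ openCluster (ends '' (↑(({0, 1, 2, 3, 5, 6} : Finset (Fin 7)) \ s) : Set (Fin 7))) 0),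
      (f (openCluster (ends '' (↑s : Set (Fin 7))) 0) - f (openCluster (ends '' (↑(({0, 1, 2, 3, 5, 6} : Finset (Fin 7)) \ s) : Set (Fin 7))) 0)) *
        (g (openCluster (ends '' (↑s : Set (Fin 7))) 0) - g (openCluster (ends '' (↑(({0, 1, 2, 3, 5, 6} : Finset (Fin 7)) \ s) : Set (Fin 7))) 0)) := by
  have hends' := hends
  subst hends
  set en : Fin 7 → Sym2 (Fin 5) := ![s(0, 2), s(0, 3), s(1, 2), s(1, 3), s(2, 3), s(2, 4), s(4, 3)] with hen
  -- the subdivision lemma with `E = W₀ = {0,1,2,3,4}`, `e = 4 = ab`, `h₁ = 5 = ac`, `h₂ = 6 = cb`, `m = m' = c = 4`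
  have hC4 : ∀ φ ψ : Set (Fin 5) → ℝ, Monotone φ → Monotone ψ →
      0 ≤ ∑ s ∈ (({0, 1, 2, 3, 4} : Finset (Fin 7)).erase 4).powerset.filter (fun s : Finset (Fin 7) =>
          (1 : Fin 5) ∉ openCluster (en '' (↑s : Set (Fin 7))) 0 ∧
          (1 : Fin 5) ∉ openCluster (en '' (↑((({0, 1, 2, 3, 4} : Finset (Fin 7)).erase 4) \ s) : Set (Fin 7))) 0),
        (φ (openCluster (en '' (↑s : Set (Fin 7))) 0) - φ (openCluster (en '' (↑((({0, 1, 2, 3, 4} : Finset (Fin 7)).erase 4) \ s) : Set (Fin 7))) 0)) *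
          (ψ (openCluster (en '' (↑s : Set (Fin 7))) 0) -
            ψ (openCluster (en '' (↑((({0, 1, 2, 3, 4} : Finset (Fin 7)).erase 4) \ s) : Set (Fin 7))) 0)) := by
    have hE : (({0, 1, 2, 3, 4} : Finset (Fin 7)).erase 4) = {0, 1, 2, 3} := by decide
    rw [hE]
    intro φ ψ hφ hψ
    exact cwpa_theta_C4 en hends' φ ψ hφ hψ
  have main := cwpa_subdivide en (E := {0, 1, 2, 3, 4}) (e := 4) (h₁ := 5) (h₂ := 6) (u := (2 : Fin 5)) (v := (3 : Fin 5)) (m := (4 : Fin 5))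
    (m' := (4 : Fin 5)) (x := (0 : Fin 5)) (z := (1 : Fin 5))
    theta_ends_vals.2.2.2.2.1 theta_ends_vals.2.2.2.2.2.1 theta_ends_vals.2.2.2.2.2.2 (by decide) (by decide) (by decide) (by decide) (by decide)
    theta_W0_facts.2 (by decide) (by decide) (by decide) (by decide)
    (fun φ ψ hφ hψ => cwpa_theta_W0_marked en hends' φ ψ hφ hψ) hC4 f g hf hg
  have hE' : insert (5 : Fin 7) (insert 6 (({0, 1, 2, 3, 4} : Finset (Fin 7)).erase 4)) = {0, 1, 2, 3, 5, 6} := by decide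
  rw [hE'] at main
  -- the marker `m' = m = c` is absorbed: `C_x(s) ∪ {c | … ∧ c ∈ C_x(s)} = C_x(s)`
  have absorb : ∀ (X : Set (Fin 5)) (P : Prop), X ∪ {y | y = 4 ∧ P ∧ (4 : Fin 5) ∈ X} = X := by
    intro X P; ext y
    simp only [Set.mem_union, Set.mem_setOf_eq]
    constructor
    · rintro (h | ⟨rfl, _, h⟩) <;> exact h
    · exact Or.inl
  simp only [absorb] at main
  exact main

end Coefficientwise

end Summit.CriticalPhenomena.PercolationContinuityZ3.Theorems
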